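import Summits.QuantumFields.BalabanUV.T4Continuum.Support.VariationalVectorRegularityRho
import Summits.QuantumFields.BalabanUV.T4Continuum.Support.VariationalVectorGaugeSliceTower
import Summits.QuantumFields.BalabanUV.T4Continuum.Support.CTGaugeTerm

/-!
# T⁴ programme, spine node NE2 (U1a), lane P2 — leaf V-REG (1-forms), file 6: V-REG AT `U = 1` FOR BAŁABAN's GAUGE FUNCTIONAL `projG 1 (ker Q′_1)`
# (the `hREG` socket of leaf-10-g3's flat END) — CLOSED MODULO THE V-UB CONSTANT `Λ`: the one operator inequality it needs, `‖∂·P·∂ᴴ‖ ≤ C` for pv15's typed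
# `P = PcT n M n` ([B5] (1.126)'s content in operator-norm form), is DISCHARGED from the substrate cell's factorisation `∂·PcT·∂ᴴ = X·K⁻¹·Xᴴ` (`CTGaugeTerm`):
# `rhoV n M 1 W ≤ (8Λ + 8·(BXp(d,1)²σ₀(d,1)⁻²)²·(d+1)·Cst(d,1))·(ScV n M 1 (projG 1 K) W + nsqV M φ)` at every constrained minimiser of the flat line-sum
# average's fibre (model level, `E = ℂ`; cell `pub-balaban`, NE2 formalisation swarm, leaf prover 03 gen 5)

HONEST FRAMING (T4-DAG p. 1).  Rung (B)+1 only — NOT infinite volume, NOT a mass gap, NOT Clay.  NE2 is NOT IN PRINT and NOT proved here.  MODEL LEVEL at FLAT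
data (`R = 1`, line transports `1`): the free field.  This file is WIRING ([folklore]) of file 3/4 (`hREG_rhoV`, GENERAL gauge matrix with the (REG-G) binder)
with leaf-09-g7's kernel facts at `U = 1` — `VariationalVectorGaugeSliceTower.{GmFlat, GmFlat_posSemidef, projG_flat_eq_qform}` (the matrix of `projG` is
`n⁻²·∂(I − P)∂ᴴ`), `VariationalVectorGaugeSliceB5.{hPc_flat, garding_flat, GradOpH_unc}` (V-P and (Går) at `U = 1` from (1.90), kernel pass 6) —, pv15's
`B5Action121.GradOp` ∕ `B5Value126.PcT`, and the substrate cell's `CTGaugeTerm.{gaugeTerm_eq_factor, opNorm_Xp_le}` + `ScalarAveragedCompression.opNorm_Kcomp_inv_le`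
(`∂·PcT·∂ᴴ = X·Kcomp⁻¹·Xᴴ`, `‖X‖ ≤ √(1/γ′)`, `‖Kcomp⁻¹‖ ≤ σ₀⁻²` — so `‖∂·PcT·∂ᴴ‖ ≤ (1/γ′)·σ₀⁻²` UNIFORMLY in `n`, §3; [B5] prints the stronger KERNEL decay (1.126),
which is NOT used).  §2 keeps the operator bound as a displayed hypothesis `hDPD` (any `C`), §3 discharges it.  No `def`, no `sorry`; axioms standard.
HONEST DEPENDENCY (cell, verbatim): continuum YM on T⁴ ⇐ BetaPertH ∧ nine spine estimates (0/9 proved); BetaPertH ⇐ (D1) ∧ (D4) ∧ CAP+tail; G-an2-4 gates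
asym, D1 and NE2/3/4.

THE MECHANISM.  For `Gm = GmFlat = n⁻²·(∂∂ᴴ − ∂P∂ᴴ)` the gauge-form gradient defect of file 3/4 is EXACTLY `defG W = n⁻²·cur (∂P∂ᴴ · unc W)` (`unc_defG_flat`:
`n⁻²·∂∂ᴴ` acts as the flat `D div`), so (REG-G) holds with `cG = 0`, `cG′ = C_∂P∂²` (`hRG_flat`); the plaquette defect is `0`; (Går) and V-P are leaf-09-g7's
`garding_flat` ∕ `hPc_flat` with `CGar = CGar′ = C_P = (d+1)·Cst(d,1)`; file 3/4's `hREG_rhoV` then gives the END's `hREG k` binder at flat data with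
`C_R = 8Λ + 8·C_∂P∂²·(d+1)·Cst(d,1)` (`hREG_flat`); with §3's `C_∂P∂ = BXp(d,1)²·σ₀(d,1)⁻²` this is `hREG_flat_closed` — the ONLY displayed binder left is
V-UB's `Λ` (leaf-10-g3 discharges it at flat data by `exists_ubV_frame_ScV` + the slice move).  V-ONE(slice′) remains the flat END's other open socket.
-/

noncomputable section

open scoped BigOperators ComplexConjugate ComplexOrder Matrix Matrix.Norms.L2Operator

namespace Summit.QuantumFields.BalabanUV.T4Continuum.VariationalVectorRegularityFlat

open Finset
open Literature.Analysis.Complex (qform)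
open Literature.MathematicalPhysics.QuantumFieldTheory.Balaban1983to89
open Literature.MathematicalPhysics.QuantumFieldTheory.Balaban1983to89.B5Prop11Plancherel (Tor fine unitVec Cst)
open Literature.MathematicalPhysics.QuantumFieldTheory.Balaban1983to89.B5Prop11Lower (nsq nsq_nonneg nsq_mulVec_le)
open Literature.MathematicalPhysics.QuantumFieldTheory.Balaban1983to89.B5Action121 (GradOp GradOp_mulVec sdiff_mulVec)
open Literature.MathematicalPhysics.QuantumFieldTheory.Balaban1983to89.B5Value126 (PcT)
open Summit.QuantumFields.BalabanUV.T4Continuum.VariationalColourBochner (Dirv)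
open Summit.QuantumFields.BalabanUV.T4Continuum.VariationalVectorBochner (gradDivV)
open Summit.QuantumFields.BalabanUV.T4Continuum.VariationalVectorWeitzenbock (divV)
open Summit.QuantumFields.BalabanUV.T4Continuum.VectorBlockTrialForm (nsqV nsqV_nonneg QvL roughV)
open Summit.QuantumFields.BalabanUV.T4Continuum.VariationalVectorForm (ScV qWV)
open Summit.QuantumFields.BalabanUV.T4Continuum.VariationalVectorEffective (unc cur cur_unc unc_cur)
open Summit.QuantumFields.BalabanUV.T4Continuum.VariationalVectorOneStepPhys (rhoV)
open Summit.QuantumFields.BalabanUV.T4Continuum.VariationalVectorGaugeSlice (projG)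
open Summit.QuantumFields.BalabanUV.T4Continuum.VariationalVectorGaugeSliceFlat (kerAvgFlat)
open Summit.QuantumFields.BalabanUV.T4Continuum.VariationalVectorGaugeSliceB5 (flatR GradOpH_unc hPc_flat garding_flat nsq_unc_fine)
open Summit.QuantumFields.BalabanUV.T4Continuum.VariationalVectorGaugeSliceTower (GmFlat GmFlat_posSemidef projG_flat_eq_qform)
open Summit.QuantumFields.BalabanUV.T4Continuum.VariationalVectorRegularityRho (defG hREG_rhoV)
open Summit.QuantumFields.BalabanUV.T4Continuum.CTGaugeTerm (Xp BXp gaugeTerm_eq_factor opNorm_Xp_le)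
open Summit.QuantumFields.BalabanUV.T4Continuum.ScalarAveragedCompression (Kcomp sigma0 sigma0_pos opNorm_Kcomp_inv_le)

variable {d : ℕ} (n : ℕ) [NeZero n] (M : Fin d → ℕ) [hM : ∀ μ, NeZero (M μ)]

/-! ## §1 The gauge-form gradient defect of `GmFlat` is `n⁻²·∂P∂ᴴ` -/

/-- `n⁻²·∂∂ᴴ` on an uncurried 1-form is the flat `D div`: `∂(∂ᴴ unc W) (x,ν) = n²·(D div_1 W)_ν(x)`. [folklore] -/
theorem GradOp_GradOpH_unc (W : Tor (fine n M) → Fin d → ℂ) (x : Tor (fine n M)) (ν : Fin d) :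
    (GradOp (fine n M) (n : ℂ) *ᵥ ((GradOp (fine n M) (n : ℂ))ᴴ *ᵥ unc W)) (x, ν) = (n : ℂ) ^ 2 * gradDivV (fine n M) (flatR n M) W x ν := by
  rw [GradOp_mulVec, sdiff_mulVec, GradOpH_unc]
  unfold gradDivV Dirv VariationalColourFederbush.cDv
  simp only [flatR, ContinuousLinearMap.coe_id', id_eq, ContinuousLinearMap.one_def]
  ring

/-- **THE DEFECT IS `n⁻²·∂P∂ᴴ`**: `unc (defG n M 1 GmFlat W) = n⁻² • (∂·P·∂ᴴ · unc W)`. [folklore] -/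
theorem unc_defG_flat (W : Tor (fine n M) → Fin d → ℂ) :
    unc (defG n M (flatR n M) (GmFlat n M) W)
      = (((n : ℂ) ^ 2)⁻¹ : ℂ) • ((GradOp (fine n M) (n : ℂ) * PcT n M (n : ℂ) * (GradOp (fine n M) (n : ℂ))ᴴ) *ᵥ unc W) := by
  have hn : (n : ℂ) ≠ 0 := by exact_mod_cast NeZero.ne n
  have hn2 : (n : ℂ) ^ 2 ≠ 0 := pow_ne_zero 2 hn
  funext p
  obtain ⟨x, ν⟩ := p
  -- unfold `GmFlat = n⁻² • (∂ (1 − P) ∂ᴴ) = n⁻² • (∂∂ᴴ − ∂P∂ᴴ)`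
  have hG : GmFlat n M *ᵥ unc W
      = (((n : ℂ) ^ 2)⁻¹ : ℂ) • (GradOp (fine n M) (n : ℂ) *ᵥ ((GradOp (fine n M) (n : ℂ))ᴴ *ᵥ unc W))
        - (((n : ℂ) ^ 2)⁻¹ : ℂ) • ((GradOp (fine n M) (n : ℂ) * PcT n M (n : ℂ) * (GradOp (fine n M) (n : ℂ))ᴴ) *ᵥ unc W) := by
    unfold GmFlat
    rw [Matrix.smul_mulVec, Matrix.mul_sub, Matrix.mul_one, Matrix.sub_mul, Matrix.sub_mulVec, smul_sub, ← Matrix.mulVec_mulVec]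
  simp only [unc, defG, cur, hG, Pi.sub_apply, Pi.smul_apply, smul_eq_mul, GradOp_GradOpH_unc]
  field_simp
  ring

/-- **(REG-G) AT FLAT DATA from the operator bound**: `‖∂P∂ᴴ‖ ≤ C ⟹ (n⁴/n^d)·nsqV (defG W) ≤ 0·ScV W + C²·qWV W`. [folklore] -/
theorem hRG_flat {C : ℝ} (hDPD : ‖GradOp (fine n M) (n : ℂ) * PcT n M (n : ℂ) * (GradOp (fine n M) (n : ℂ))ᴴ‖ ≤ C)
    (W : Tor (fine n M) → Fin d → ℂ) :
    (n : ℝ) ^ 4 / (n : ℝ) ^ d * nsqV (fine n M) (defG n M (flatR n M) (GmFlat n M) W)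
      ≤ 0 * ScV n M (flatR n M) (projG (fine n M) (flatR n M) (kerAvgFlat n M)) W + C ^ 2 * qWV n M W := by
  have hn : (0 : ℝ) < (n : ℝ) := by exact_mod_cast Nat.pos_of_ne_zero (NeZero.ne n)
  have hnd : (0 : ℝ) < (n : ℝ) ^ d := pow_pos hn d
  set B := GradOp (fine n M) (n : ℂ) * PcT n M (n : ℂ) * (GradOp (fine n M) (n : ℂ))ᴴ with hB
  -- `nsqV (defG W) = n⁻⁴ · nsq (B · unc W)`
  have h1 : nsqV (fine n M) (defG n M (flatR n M) (GmFlat n M) W) = ((n : ℝ) ^ 2)⁻¹ ^ 2 * nsq (B *ᵥ unc W) := by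
    rw [← nsq_unc_fine, unc_defG_flat, ScalarBlockPoincare.nsq_smul]
    congr 1
    rw [norm_inv, norm_pow, Complex.norm_natCast]
  have h2 : nsq (B *ᵥ unc W) ≤ C ^ 2 * nsq (unc W) :=
    (nsq_mulVec_le B (unc W)).trans (mul_le_mul_of_nonneg_right (pow_le_pow_left₀ (norm_nonneg _) hDPD 2) (nsq_nonneg _))
  rw [nsq_unc_fine] at h2
  rw [zero_mul, zero_add, h1]
  unfold qWV
  have e : (n : ℝ) ^ 4 / (n : ℝ) ^ d * (((n : ℝ) ^ 2)⁻¹ ^ 2 * nsq (B *ᵥ unc W)) = ((n : ℝ) ^ d)⁻¹ * nsq (B *ᵥ unc W) := by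
    field_simp
  rw [e]
  calc ((n : ℝ) ^ d)⁻¹ * nsq (B *ᵥ unc W) ≤ ((n : ℝ) ^ d)⁻¹ * (C ^ 2 * nsqV (fine n M) W) := mul_le_mul_of_nonneg_left h2 (by positivity)
    _ = C ^ 2 * (((n : ℝ) ^ d)⁻¹ * nsqV (fine n M) W) := by ring

/-! ## §2 V-REG at `U = 1` for Bałaban's gauge functional, modulo `‖∂P∂ᴴ‖ ≤ C_∂P∂` -/

omit [NeZero n] hM in
/-- flat bond transports are unitary. [folklore] -/
theorem flatR_mem_unitary (x : Tor (fine n M)) (μ : Fin d) : flatR n M x μ ∈ unitary (ℂ →L[ℂ] ℂ) := Submonoid.one_mem _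

omit [NeZero n] hM in
/-- flat bond transports have plaquette defect `0`. [folklore] -/
theorem flatR_plaquette (x : Tor (fine n M)) (μ ν : Fin d) :
    ‖flatR n M x μ * flatR n M (x + unitVec (fine n M) μ) ν - flatR n M x ν * flatR n M (x + unitVec (fine n M) ν) μ‖ ≤ 0 := by
  simp [flatR]

/-- **LEAF V-REG AT `U = 1` FOR BAŁABAN's GAUGE FUNCTIONAL, MODULO (1.126)'s OPERATOR NORM** (model level, `E = ℂ`, flat data): given
`hDPD : ‖∂·P·∂ᴴ‖ ≤ C_∂P∂` (pv15's typed `GradOp`, `PcT` at lattice factor `n`) and a V-UB constant `Λ` for `ScV n M 1 (projG 1 (ker Q′_1))` on the fibres of the flat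
line-sum average, THE `hREG k` BINDER OF THE FLAT END: for every datum `φ` and every constrained minimiser `W`,
`rhoV n M 1 W ≤ (8Λ + 8·C_∂P∂²·((d+1)·Cst(d,1)))·(ScV n M 1 (projG 1 (ker Q′_1)) W + nsqV M φ)` — (Går) and V-P are leaf-09-g7's kernel facts (1.90), (REG-G) is §1,
the plaquette defect is `0`.  [folklore] -/
theorem hREG_flat {C : ℝ} (hDPD : ‖GradOp (fine n M) (n : ℂ) * PcT n M (n : ℂ) * (GradOp (fine n M) (n : ℂ))ᴴ‖ ≤ C)
    {Λ : ℝ} (hΛ : 0 ≤ Λ)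
    (hUBc : ∀ φ : Tor M → Fin d → ℂ, ∃ W, QvL n M (fun _ _ _ _ => (1 : ℂ →L[ℂ] ℂ)) W = φ ∧
      ScV n M (flatR n M) (projG (fine n M) (flatR n M) (kerAvgFlat n M)) W ≤ Λ * nsqV M φ) :
    ∀ (φ : Tor M → Fin d → ℂ) (W : Tor (fine n M) → Fin d → ℂ), QvL n M (fun _ _ _ _ => (1 : ℂ →L[ℂ] ℂ)) W = φ →
      (∀ W₂, QvL n M (fun _ _ _ _ => (1 : ℂ →L[ℂ] ℂ)) W₂ = φ →
        ScV n M (flatR n M) (projG (fine n M) (flatR n M) (kerAvgFlat n M)) W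
          ≤ ScV n M (flatR n M) (projG (fine n M) (flatR n M) (kerAvgFlat n M)) W₂) →
      rhoV n M (flatR n M) W
        ≤ (8 * Λ + 8 * C ^ 2 * ((d + 1 : ℝ) * Cst d 1))
          * (ScV n M (flatR n M) (projG (fine n M) (flatR n M) (kerAvgFlat n M)) W + nsqV M φ) := by
  intro φ W hW hmin
  have hCP : (0 : ℝ) ≤ (d + 1 : ℝ) * Cst d 1 := by
    have := B5Prop11Plancherel.Cst_nonneg d (1 : ℝ)
    positivity
  -- (Går) at `U = 1` (leaf-09-g7, from (1.90)) in the two-constant shape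
  have hGar : ∀ W, ((n : ℝ) ^ d)⁻¹ * ((n : ℝ) ^ 2 * roughV n M (flatR n M) W)
      ≤ ((d + 1 : ℝ) * Cst d 1) * ScV n M (flatR n M) (projG (fine n M) (flatR n M) (kerAvgFlat n M)) W
        + ((d + 1 : ℝ) * Cst d 1) * nsqV M (QvL n M (fun _ _ _ _ => (1 : ℂ →L[ℂ] ℂ)) W) := fun W => by
    have h := garding_flat n M one_pos W
    rw [one_mul] at h
    linarith
  have h := hREG_rhoV n M (R := flatR n M) (flatR_mem_unitary n M) le_rfl (flatR_plaquette n M) (GmFlat_posSemidef n M)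
    (fun W => projG_flat_eq_qform n M W) (T := fun _ _ _ _ => (1 : ℂ →L[ℂ] ℂ)) (fun _ _ _ _ => by rw [norm_one]) hΛ hCP hCP le_rfl
    (sq_nonneg C) hUBc (hPc_flat n M) hGar (hRG_flat n M hDPD) φ W hW hmin
  have e : 8 * Λ + 8 * (0 : ℝ) + 2 * d * ((n : ℝ) ^ 2 * 0) * ((d + 1 : ℝ) * Cst d 1 + (d + 1 : ℝ) * Cst d 1)
      + (8 * C ^ 2 + 5 * (d : ℝ) ^ 2 * ((n : ℝ) ^ 2 * 0) ^ 2) * ((d + 1 : ℝ) * Cst d 1)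
      = 8 * Λ + 8 * C ^ 2 * ((d + 1 : ℝ) * Cst d 1) := by ring
  rwa [e] at h

/-! ## §3 The operator inequality DISCHARGED: `‖∂·P·∂ᴴ‖ ≤ (1/γ′)·σ₀⁻²` from the substrate's factorisation `∂·PcT·∂ᴴ = X·K⁻¹·Xᴴ` -/

/-- **`‖∂·PcT·∂ᴴ‖ ≤ BXp(d,a′)²·σ₀(d,a′)⁻²` for every `a′ > 0`, UNIFORMLY in `n`** — from the substrate cell's `CTGaugeTerm.gaugeTerm_eq_factor` (`∂·PcT·∂ᴴ = X·Kcomp⁻¹·Xᴴ`,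
`X = ∂G′Q̃′ᴴ`), `opNorm_Xp_le` (`‖X‖ ≤ √(1/γ′)`) and `ScalarAveragedCompression.opNorm_Kcomp_inv_le` (`‖Kcomp⁻¹‖ ≤ σ₀⁻²`).  This is the operator-norm content
of [B5] (1.126) for pv15's typed `PcT`, obtained WITHOUT the kernel decay. [folklore] -/
theorem opNorm_gaugeTerm_le {a' : ℝ} (ha' : 0 < a') :
    ‖GradOp (fine n M) (n : ℂ) * PcT n M (n : ℂ) * (GradOp (fine n M) (n : ℂ))ᴴ‖ ≤ BXp d a' ^ 2 * ((sigma0 d a') ^ 2)⁻¹ := by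
  have hX := opNorm_Xp_le n M ha'
  have hK := opNorm_Kcomp_inv_le n M ha'
  have hX0 : 0 ≤ BXp d a' := Real.sqrt_nonneg _
  rw [gaugeTerm_eq_factor n M ha']
  calc ‖Xp n M a' * (Kcomp n M a')⁻¹ * (Xp n M a')ᴴ‖ ≤ ‖Xp n M a' * (Kcomp n M a')⁻¹‖ * ‖(Xp n M a')ᴴ‖ := Matrix.l2_opNorm_mul _ _
    _ ≤ (‖Xp n M a'‖ * ‖(Kcomp n M a')⁻¹‖) * ‖Xp n M a'‖ := by
        rw [Matrix.l2_opNorm_conjTranspose]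
        exact mul_le_mul_of_nonneg_right (Matrix.l2_opNorm_mul _ _) (norm_nonneg _)
    _ ≤ (BXp d a' * ((sigma0 d a') ^ 2)⁻¹) * BXp d a' :=
        mul_le_mul (mul_le_mul hX hK (norm_nonneg _) hX0) hX (norm_nonneg _) (by positivity)
    _ = BXp d a' ^ 2 * ((sigma0 d a') ^ 2)⁻¹ := by ring

/-- **LEAF V-REG AT `U = 1` FOR BAŁABAN's GAUGE FUNCTIONAL — CLOSED MODULO V-UB** (model level, `E = ℂ`, flat data): the flat END's `hREG k` binder with the
operator inequality of §2 DISCHARGED by §3 (`a′ = 1`): for every datum `φ` and every constrained minimiser `W` of `ScV n M 1 (projG 1 (ker Q′_1))` on the fibre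
of the flat line-sum average, `rhoV n M 1 W ≤ (8Λ + 8·(BXp(d,1)²σ₀(d,1)⁻²)²·(d+1)·Cst(d,1))·(ScV n M 1 (projG 1 (ker Q′_1)) W + nsqV M φ)` — the ONLY displayed
binder is the V-UB constant `Λ` (leaf-10-g3 discharges it at flat data by `exists_ubV_frame_ScV` + the slice move).  k-UNIFORM: every constant depends on `d` only. [folklore] -/
theorem hREG_flat_closed {Λ : ℝ} (hΛ : 0 ≤ Λ)
    (hUBc : ∀ φ : Tor M → Fin d → ℂ, ∃ W, QvL n M (fun _ _ _ _ => (1 : ℂ →L[ℂ] ℂ)) W = φ ∧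
      ScV n M (flatR n M) (projG (fine n M) (flatR n M) (kerAvgFlat n M)) W ≤ Λ * nsqV M φ) :
    ∀ (φ : Tor M → Fin d → ℂ) (W : Tor (fine n M) → Fin d → ℂ), QvL n M (fun _ _ _ _ => (1 : ℂ →L[ℂ] ℂ)) W = φ →
      (∀ W₂, QvL n M (fun _ _ _ _ => (1 : ℂ →L[ℂ] ℂ)) W₂ = φ →
        ScV n M (flatR n M) (projG (fine n M) (flatR n M) (kerAvgFlat n M)) W
          ≤ ScV n M (flatR n M) (projG (fine n M) (flatR n M) (kerAvgFlat n M)) W₂) →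
      rhoV n M (flatR n M) W
        ≤ (8 * Λ + 8 * (BXp d 1 ^ 2 * ((sigma0 d 1) ^ 2)⁻¹) ^ 2 * ((d + 1 : ℝ) * Cst d 1))
          * (ScV n M (flatR n M) (projG (fine n M) (flatR n M) (kerAvgFlat n M)) W + nsqV M φ) :=
  hREG_flat n M (opNorm_gaugeTerm_le n M one_pos) hΛ hUBc

end Summit.QuantumFields.BalabanUV.T4Continuum.VariationalVectorRegularityFlat

end
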